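import Literature.Algebra.EuclideanLattices.GaussianCosetSmoothing
import Mathlib.MeasureTheory.Constructions.Pi
import HarnessLib

/-!
# Statistical distance of measures: triangle inequality, data processing, products, mixtures

Topic `Algebra/EuclideanLattices` (family `pqc`); theorems-only companion of the LOCAL GLUE
`statDist μ ν = sup_A |μ(A) - ν(A)|` of `GaussianCosetSmoothing.lean` (the measure version of the tree's
`PMF.tvDist`; `IIDStatisticalDistance.lean` proves the analogous facts for `PMF`s). These are the
composition rules used to pass from ONE-sample statements (BLPRS 2013, Lemma 3.5:
`Cryptography/LWEModulusSwitch.lean`) to `m` independent samples and a random secret (BLPRS 2013,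
Thm. 3.1 / Cor. 3.2: "reduces the advantage by at most `δ + 14εm`"), in the decomposition of
`Literature.Computability.Cryptography.blprs_gapSVP_sqrt_dim_to_lwe_classical` (pqc.S21). Everything is
PROVED; no definition, no named fact.

## Results

* `statDist_triangle`, `statDist_le_one` (probability measures), `statDist_map_le` (**data
  processing**: `Δ(f_*μ, f_*ν) ≤ Δ(μ, ν)`), `statDist_map_equiv` (invariance under `≃ᵐ`).
* `measure_le_measure_add_ofReal_statDist` (`μ(A) ≤ ν(A) + Δ` in `ℝ≥0∞`) and
  `abs_toReal_sub_toReal_le` (back to `|a - b| ≤ Δ`): the device that lets all bounds below be proved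
  by monotonicity of `∫⁻` and `∑'`.
* **Products**: `statDist_prod_right_le` / `statDist_prod_left_le` (one common factor),
  `statDist_prod_le` (`Δ(μ₁⊗μ₂, ν₁⊗ν₂) ≤ Δ(μ₁,ν₁) + Δ(μ₂,ν₂)`), and the hybrid bound
  **`statDist_pi_le_sum`: `Δ(⊗ᵢ μᵢ, ⊗ᵢ νᵢ) ≤ ∑ᵢ Δ(μᵢ, νᵢ)`** for `Measure.pi` over `Fin m` (induction
  along Mathlib's `measurePreserving_piFinSuccAbove`).
* **Mixtures**: `statDist_sum_smul_le`: `Δ(∑ₛ wₛμₛ, ∑ₛ wₛνₛ) ≤ ∑ₛ wₛ Δ(μₛ, νₛ)` for weights summing to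
  one (e.g. a random secret `s ← 𝒟`).

## References

* O. Goldreich, *Foundations of Cryptography I*, CUP 2001, §3.2.3 (hybrid arguments; Thm. 3.2.6)
  [Goldreich2001].
* Z. Brakerski, A. Langlois, C. Peikert, O. Regev, D. Stehlé, *Classical hardness of learning with
  errors*, STOC 2013, §2 (statistical distance "extended to continuous distributions in the obvious
  way"), Thm. 3.1 [BrakerskiEtAl2013].
-/

noncomputable section

open MeasureTheory
open scoped ENNReal

namespace Literature.Algebra.EuclideanLattices

variable {α β : Type*} [MeasurableSpace α] [MeasurableSpace β]

/-! ### Triangle inequality, trivial bound, data processing -/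

/-- Triangle inequality for the statistical distance of finite measures. [folklore] -/
theorem statDist_triangle (μ ν ρ : Measure α) [IsFiniteMeasure μ] [IsFiniteMeasure ν]
    [IsFiniteMeasure ρ] : statDist μ ρ ≤ statDist μ ν + statDist ν ρ := by
  refine statDist_le_of_forall_abs_sub_le (add_nonneg (statDist_nonneg _ _) (statDist_nonneg _ _))
    fun A hA => ?_
  have h1 := abs_measureReal_sub_le_statDist μ ν hA
  have h2 := abs_measureReal_sub_le_statDist ν ρ hA
  calc |μ.real A - ρ.real A| = |(μ.real A - ν.real A) + (ν.real A - ρ.real A)| := by ring_nf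
    _ ≤ |μ.real A - ν.real A| + |ν.real A - ρ.real A| := abs_add_le _ _
    _ ≤ statDist μ ν + statDist ν ρ := add_le_add h1 h2

/-- Two probability measures are at statistical distance at most `1`. [folklore] -/
theorem statDist_le_one (μ ν : Measure α) [IsProbabilityMeasure μ] [IsProbabilityMeasure ν] :
    statDist μ ν ≤ 1 :=
  statDist_le_of_forall_abs_sub_le zero_le_one fun A _ =>
    abs_sub_le_iff.2 ⟨by linarith [measureReal_le_one (μ := μ) (s := A), measureReal_nonneg (μ := ν) (s := A)],
      by linarith [measureReal_le_one (μ := ν) (s := A), measureReal_nonneg (μ := μ) (s := A)]⟩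

/-- **Data processing**: pushing two measures forward along the same measurable map does not increase
their statistical distance. [folklore] -/
theorem statDist_map_le {f : α → β} (hf : Measurable f) (μ ν : Measure α) [IsFiniteMeasure μ]
    [IsFiniteMeasure ν] : statDist (μ.map f) (ν.map f) ≤ statDist μ ν := by
  refine statDist_le_of_forall_abs_sub_le (statDist_nonneg _ _) fun B hB => ?_
  rw [measureReal_def, measureReal_def, Measure.map_apply hf hB, Measure.map_apply hf hB,
    ← measureReal_def, ← measureReal_def]
  exact abs_measureReal_sub_le_statDist μ ν (hf hB)

/-- Statistical distance is invariant under measurable equivalences. [folklore] -/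
theorem statDist_map_equiv (e : α ≃ᵐ β) (μ ν : Measure α) [IsFiniteMeasure μ] [IsFiniteMeasure ν] :
    statDist (μ.map e) (ν.map e) = statDist μ ν := by
  refine le_antisymm (statDist_map_le e.measurable μ ν) ?_
  have h := statDist_map_le e.symm.measurable (μ.map e) (ν.map e)
  rwa [MeasurableEquiv.map_symm_map, MeasurableEquiv.map_symm_map] at h

/-! ### From a bound on `|μ(A) - ν(A)|` to one-sided bounds in `ℝ≥0∞` -/

/-- `μ(A) ≤ ν(A) + Δ(μ, ν)` in `ℝ≥0∞`. [folklore] -/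
theorem measure_le_measure_add_ofReal_statDist (μ ν : Measure α) [IsFiniteMeasure μ] [IsFiniteMeasure ν]
    {A : Set α} (hA : MeasurableSet A) :
    μ A ≤ ν A + ENNReal.ofReal (statDist μ ν) := by
  have h := (abs_le.1 (abs_measureReal_sub_le_statDist μ ν hA)).2
  have hreal : μ.real A ≤ ν.real A + statDist μ ν := by linarith
  calc μ A = ENNReal.ofReal (μ.real A) := (ENNReal.ofReal_toReal (measure_ne_top _ _)).symm
    _ ≤ ENNReal.ofReal (ν.real A + statDist μ ν) := ENNReal.ofReal_le_ofReal hreal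
    _ = ν A + ENNReal.ofReal (statDist μ ν) := by
        rw [ENNReal.ofReal_add measureReal_nonneg (statDist_nonneg _ _), measureReal_def,
          ENNReal.ofReal_toReal (measure_ne_top _ _)]

omit [MeasurableSpace α] in
/-- From two one-sided bounds in `ℝ≥0∞` to `|a - b| ≤ Δ` in `ℝ`. [folklore] -/
theorem abs_toReal_sub_toReal_le {a b : ℝ≥0∞} {Δ : ℝ} (ha : a ≠ ∞) (hb : b ≠ ∞) (hΔ : 0 ≤ Δ)
    (h₁ : a ≤ b + ENNReal.ofReal Δ) (h₂ : b ≤ a + ENNReal.ofReal Δ) : |a.toReal - b.toReal| ≤ Δ := by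
  rw [abs_le]
  constructor
  · have := ENNReal.toReal_mono (ENNReal.add_ne_top.2 ⟨ha, ENNReal.ofReal_ne_top⟩) h₂
    rw [ENNReal.toReal_add ha ENNReal.ofReal_ne_top, ENNReal.toReal_ofReal hΔ] at this
    linarith
  · have := ENNReal.toReal_mono (ENNReal.add_ne_top.2 ⟨hb, ENNReal.ofReal_ne_top⟩) h₁
    rw [ENNReal.toReal_add hb ENNReal.ofReal_ne_top, ENNReal.toReal_ofReal hΔ] at this
    linarith

/-! ### Products -/

/-- **One factor of a product**: `Δ(κ ⊗ μ, κ ⊗ ν) ≤ Δ(μ, ν)` for a probability measure `κ`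
(integrate the sectionwise bound `μ(A^x) ≤ ν(A^x) + Δ` over `x ← κ`). [folklore] -/
theorem statDist_prod_right_le (κ : Measure α) [IsProbabilityMeasure κ] (μ ν : Measure β)
    [IsProbabilityMeasure μ] [IsProbabilityMeasure ν] :
    statDist (κ.prod μ) (κ.prod ν) ≤ statDist μ ν := by
  refine statDist_le_of_forall_abs_sub_le (statDist_nonneg _ _) fun A hA => ?_
  rw [measureReal_def, measureReal_def]
  have hsec : ∀ (μ' ν' : Measure β) [IsProbabilityMeasure μ'] [IsProbabilityMeasure ν'],
      (κ.prod μ') A ≤ (κ.prod ν') A + ENNReal.ofReal (statDist μ' ν') := by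
    intro μ' ν' _ _
    rw [Measure.prod_apply hA, Measure.prod_apply hA]
    calc ∫⁻ x, μ' (Prod.mk x ⁻¹' A) ∂κ
        ≤ ∫⁻ x, ν' (Prod.mk x ⁻¹' A) + ENNReal.ofReal (statDist μ' ν') ∂κ :=
          lintegral_mono fun x =>
            measure_le_measure_add_ofReal_statDist μ' ν' (measurable_prodMk_left hA)
      _ = ∫⁻ x, ν' (Prod.mk x ⁻¹' A) ∂κ + ENNReal.ofReal (statDist μ' ν') := by
          rw [lintegral_add_right _ measurable_const, lintegral_const, measure_univ, mul_one]
  refine abs_toReal_sub_toReal_le (measure_ne_top _ _) (measure_ne_top _ _) (statDist_nonneg _ _)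
    (hsec μ ν) ?_
  rw [statDist_comm]
  exact hsec ν μ

/-- **One factor of a product**, left version: `Δ(μ ⊗ κ, ν ⊗ κ) ≤ Δ(μ, ν)`. [folklore] -/
theorem statDist_prod_left_le (μ ν : Measure α) [IsProbabilityMeasure μ] [IsProbabilityMeasure ν]
    (κ : Measure β) [IsProbabilityMeasure κ] :
    statDist (μ.prod κ) (ν.prod κ) ≤ statDist μ ν := by
  rw [← Measure.prod_swap (μ := κ) (ν := μ), ← Measure.prod_swap (μ := κ) (ν := ν)]
  exact (statDist_map_le measurable_swap _ _).trans (statDist_prod_right_le κ μ ν)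

/-- **Hybrid step for binary products**: `Δ(μ₁ ⊗ μ₂, ν₁ ⊗ ν₂) ≤ Δ(μ₁, ν₁) + Δ(μ₂, ν₂)`. [folklore] -/
theorem statDist_prod_le (μ₁ ν₁ : Measure α) (μ₂ ν₂ : Measure β) [IsProbabilityMeasure μ₁]
    [IsProbabilityMeasure ν₁] [IsProbabilityMeasure μ₂] [IsProbabilityMeasure ν₂] :
    statDist (μ₁.prod μ₂) (ν₁.prod ν₂) ≤ statDist μ₁ ν₁ + statDist μ₂ ν₂ :=
  (statDist_triangle _ (ν₁.prod μ₂) _).trans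
    (add_le_add (statDist_prod_left_le μ₁ ν₁ μ₂) (statDist_prod_right_le ν₁ μ₂ ν₂))

/-- **The hybrid bound for independent samples** (Goldreich's "indistinguishability is preserved under
multiple samples", in exact measure form): `Δ(⊗ᵢ μᵢ, ⊗ᵢ νᵢ) ≤ ∑ᵢ Δ(μᵢ, νᵢ)` for finitely many probability
measures indexed by `Fin m`. [folklore] -/
theorem statDist_pi_le_sum {X : Type*} [MeasurableSpace X] :
    ∀ {m : ℕ} (μ ν : Fin m → Measure X) [∀ i, IsProbabilityMeasure (μ i)]
      [∀ i, IsProbabilityMeasure (ν i)],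
      statDist (Measure.pi μ) (Measure.pi ν) ≤ ∑ i, statDist (μ i) (ν i)
  | 0, μ, ν, _, _ => by
      rw [Measure.pi_of_empty (x := fun i => i.elim0), Measure.pi_of_empty (x := fun i => i.elim0),
        statDist_self]
      exact Finset.sum_nonneg fun i _ => statDist_nonneg _ _
  | m + 1, μ, ν, hμ, hν => by
      -- split off the coordinate `0` with the measurable equivalence `piFinSuccAbove`
      have hμe := (measurePreserving_piFinSuccAbove μ 0).map_eq
      have hνe := (measurePreserving_piFinSuccAbove ν 0).map_eq
      haveI : ∀ j, IsProbabilityMeasure ((fun j => μ (Fin.succAbove 0 j)) j) := fun j => hμ _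
      haveI : ∀ j, IsProbabilityMeasure ((fun j => ν (Fin.succAbove 0 j)) j) := fun j => hν _
      have ih := statDist_pi_le_sum (fun j => μ (Fin.succAbove 0 j)) (fun j => ν (Fin.succAbove 0 j))
      rw [← statDist_map_equiv (MeasurableEquiv.piFinSuccAbove (fun _ : Fin (m + 1) => X) 0), hμe, hνe,
        Fin.sum_univ_succAbove _ 0]
      exact (statDist_prod_le _ _ _ _).trans (add_le_add le_rfl ih)

/-! ### Mixtures -/

/-- **Mixtures**: for weights `w_s` summing to one and probability measures `μ_s, ν_s`,
`Δ(∑ w_s μ_s, ∑ w_s ν_s) ≤ ∑ w_s Δ(μ_s, ν_s)` (the right-hand side as an `ℝ≥0∞`-sum read in `ℝ`;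
each `Δ ≤ 1`, so it is at most `1`). [folklore] -/
theorem statDist_sum_smul_le {S : Type*} (w : S → ℝ≥0∞) (hw : ∑' s, w s = 1) (μ ν : S → Measure α)
    [∀ s, IsProbabilityMeasure (μ s)] [∀ s, IsProbabilityMeasure (ν s)] :
    statDist (Measure.sum fun s => w s • μ s) (Measure.sum fun s => w s • ν s) ≤
      (∑' s, w s * ENNReal.ofReal (statDist (μ s) (ν s))).toReal := by
  set Δ : ℝ≥0∞ := ∑' s, w s * ENNReal.ofReal (statDist (μ s) (ν s)) with hΔ
  have hΔle : Δ ≤ 1 := by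
    calc Δ ≤ ∑' s, w s * 1 := ENNReal.tsum_le_tsum fun s =>
          mul_le_mul_right (ENNReal.ofReal_le_one.2 (statDist_le_one _ _)) _
      _ = 1 := by simp [hw]
  have hΔtop : Δ ≠ ∞ := ne_top_of_le_ne_top ENNReal.one_ne_top hΔle
  have hsum_univ : ∀ (ρ : S → Measure α) [∀ s, IsProbabilityMeasure (ρ s)],
      (Measure.sum fun s => w s • ρ s) Set.univ = 1 := by
    intro ρ _
    rw [Measure.sum_apply _ MeasurableSet.univ]
    simp [hw]
  haveI : IsProbabilityMeasure (Measure.sum fun s => w s • μ s) := ⟨hsum_univ μ⟩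
  haveI : IsProbabilityMeasure (Measure.sum fun s => w s • ν s) := ⟨hsum_univ ν⟩
  refine statDist_le_of_forall_abs_sub_le ENNReal.toReal_nonneg fun A hA => ?_
  have hone : ∀ (ρ ρ' : S → Measure α) [∀ s, IsProbabilityMeasure (ρ s)]
      [∀ s, IsProbabilityMeasure (ρ' s)],
      (∀ s, statDist (ρ s) (ρ' s) = statDist (μ s) (ν s)) →
      (Measure.sum fun s => w s • ρ s) A ≤ (Measure.sum fun s => w s • ρ' s) A + Δ := by
    intro ρ ρ' _ _ hρ
    rw [Measure.sum_apply _ hA, Measure.sum_apply _ hA, hΔ, ← ENNReal.tsum_add]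
    refine ENNReal.tsum_le_tsum fun s => ?_
    rw [Measure.smul_apply, Measure.smul_apply, smul_eq_mul, smul_eq_mul, ← hρ s, ← mul_add]
    exact mul_le_mul_right (measure_le_measure_add_ofReal_statDist _ _ hA) _
  rw [measureReal_def, measureReal_def]
  refine abs_toReal_sub_toReal_le (measure_ne_top _ _) (measure_ne_top _ _) ENNReal.toReal_nonneg
    ?_ ?_
  · rw [ENNReal.ofReal_toReal hΔtop]
    exact hone μ ν fun s => rfl
  · rw [ENNReal.ofReal_toReal hΔtop]
    exact hone ν μ fun s => statDist_comm _ _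

end Literature.Algebra.EuclideanLattices

end
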